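import Summits.CriticalPhenomena.PercolationContinuityZ3.Theorems.PercNearOneGluingNoHeavyLowerTailCILIsolatedObserver
import HarnessLib

/-!
# `NoHeavyLowerTail` (stmt-CriticalPhenomena-4575) — Kozma–Nitzan GOODNESS for relay counts implies the
# cumulative isolation lemma (the induction-friendly form of the CIL engine)

Support file for the crux `NoHeavyLowerTail` (routes `PercNearOneGluing`, `PercNearOneGluingNoHeavy`;
`--supports stmt-CriticalPhenomena-4575`), blob-quotient / cumulative-isolation line (depth prover
`nh-dp-blobmono`).  No definitions, no named facts, no sorries.

Notation: `μ = prodBernoulli w` on `Fin n`, relays `A`, observer `o`, `N = |{x ∈ A : o ↔ x}|`,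
`π(a) = {x ∈ A : a ↔ x}`, level `k = j+1`, `U_k(x) = {|π(x)| ≥ k}`; CIL_j is
`∃ a ∈ A, μ{1 ≤ N ≤ j} ≤ μ{|π(a)| ≤ j}` (registered stub `stub_cumulativeIsolation`).

Kozma–Nitzan (arXiv:2401.12397, §3.2 p. 12) prove their "`0` close to `A`" cases through the notion of a
GOOD quadruple: `P(0 ↔ b) ≥ min_a P(a ↔ b) − Σ_{W ∩ A = ∅} P(C(0) = W)·min_a P_{G∖W}(a ↔ b)`, the sum
over the relay-free clusters `W` of `0`; goodness implies their pre-FKG inequality, and it is what their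
one-vertex induction (Theorem 5) propagates.  For the relay-count property the same notion reads

  `Good_k(G, A, o)`:  `min_{a∈A} μ(U_k(a)) ≤ μ(N ≥ k) + Σ_W min_{a∈A} μ(C(o) = W, N = 0, U_k(a))`,

`W` over vertex sets (as `μ(C(o) = W)·μ_{G∖W}(U_k(a)) = μ(C(o) = W, U_k(a))`, no conditioning is needed to
state it).  This file TYPES `Good_k` in the tree's vocabulary (the hypothesis `hgood` below, with
`C(o) = W` read as `{v | o ↔ v} = W`) and PROVES, pointwise in the weighted graph:

* `cumulativeIsolation_of_goodness` — `Good_{j+1}(G, A, o) ⇒ CIL_j(G, A, o)` in the pre-FKG form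
  `μ{1 ≤ N ≤ j} ≤ μ({o ↔ A} ∩ {|π(a⋆)| ≤ j})`, with the witness `a⋆` = ANY minimiser of `μ(U_{j+1}(·))` over
  `A`, i.e. the plain champion `argmax_a μ{|π(a)| ≤ j}` (proof: bound each `min_a` in the error sum by the
  value at `a⋆`; the events `{C(o) = W, N = 0}` partition `{N = 0}`).

* `goodness_of_isolatedObserver` — the BASE CASE: `Good_{j+1}(G, A, o)` holds whenever `o ∉ A` is joined
  only to relays (Kozma–Nitzan's Theorem 4 bookkeeping for relay counts: the only relay-free cluster of `o`
  with positive mass is `{o}`, and its error term is `μ(σ_∅)·min_a μ_{G∖o}(|π(a)| ≥ j+1)`), via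
  `thm8_event_of_isMin` (Theorem 8 for an explicit minimiser).

So goodness for relay counts (all graphs, all `k`) ⇒ `stub_cumulativeIsolation` ⇒ the crux, and
Kozma–Nitzan's Theorem 5 mechanism is the tool that propagates goodness across one private Steiner vertex
of the observer.  Numerics for `Good_k` and for the canonical-witness forms on general weighted graphs with
Steiner neighbours of the observer (exact enumeration + adversarial hill-climbs): crux evidence
`Q9-CENSUS.md` (kit j038713, j038786, j038787).
-/

noncomputable section

namespace Summit.CriticalPhenomena.PercolationContinuityZ3.Theorems

open MeasureTheory Set Literature.Probability.LatticeModels Literature.Probability.Percolation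
open scoped Classical BigOperators

variable {n : ℕ}

/-- **Kozma–Nitzan goodness for relay counts implies the cumulative isolation lemma (pointwise).**
Hypothesis `hgood` = `Good_{j+1}(G, A, o)`: for some `a₁ ∈ A`,
`μ{|π(a₁)| ≥ j+1} ≤ μ{N ≥ j+1} + Σ_W min_{a ∈ A} μ{C(o) = W, N = 0, |π(a)| ≥ j+1}` (sum over all vertex
sets `W`; only relay-free clusters of `o` contribute).  Conclusion: CIL at level `j` in pre-FKG form, with
witness any relay `a⋆` minimising `μ{|π(·)| ≥ j+1}` over `A`. [cite: KozmaNitzan2024, §3.2 (Definition of a good quadruple, p. 12)] -/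
theorem cumulativeIsolation_of_goodness (w : Sym2 (Fin n) → unitInterval) (A : Finset (Fin n))
    (o : Fin n) (j : ℕ)
    (hgood : ∃ a₁, ∃ ha₁ : a₁ ∈ A,
      (prodBernoulli w).real {ω : BondConfig (Fin n) |
          j + 1 ≤ (A.filter fun x => ω ∈ openConn a₁ x).card} ≤
        (prodBernoulli w).real {ω : BondConfig (Fin n) |
            j + 1 ≤ (A.filter fun x => ω ∈ openConn o x).card} +
          ∑ W : Finset (Fin n), A.inf' ⟨a₁, ha₁⟩ (fun a =>
            (prodBernoulli w).real {ω : BondConfig (Fin n) |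
              (Finset.univ.filter fun v => ω ∈ openConn o v) = W ∧
                (A.filter fun x => ω ∈ openConn o x).card = 0 ∧
                  j + 1 ≤ (A.filter fun x => ω ∈ openConn a x).card})) :
    ∃ a ∈ A, (∀ a' ∈ A,
        (prodBernoulli w).real {ω : BondConfig (Fin n) |
            j + 1 ≤ (A.filter fun x => ω ∈ openConn a x).card} ≤
          (prodBernoulli w).real {ω : BondConfig (Fin n) |
            j + 1 ≤ (A.filter fun x => ω ∈ openConn a' x).card}) ∧
      (prodBernoulli w).real {ω : BondConfig (Fin n) |
          1 ≤ (A.filter fun x => ω ∈ openConn o x).card ∧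
            (A.filter fun x => ω ∈ openConn o x).card ≤ j} ≤
        (prodBernoulli w).real ((⋃ a' ∈ A, (openConn o a' : Set (BondConfig (Fin n)))) ∩
          {ω : BondConfig (Fin n) | (A.filter fun x => ω ∈ openConn a x).card ≤ j}) := by
  set μ := prodBernoulli w with hμ
  obtain ⟨a₁, ha₁, hgood⟩ := hgood
  -- notation
  set cnt : Fin n → BondConfig (Fin n) → ℕ := fun a ω => (A.filter fun x => ω ∈ openConn a x).card
    with hcnt
  set U : Fin n → Set (BondConfig (Fin n)) := fun a => {ω | j + 1 ≤ cnt a ω} with hU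
  set CW : Finset (Fin n) → Set (BondConfig (Fin n)) := fun W =>
    {ω | (Finset.univ.filter fun v => ω ∈ openConn o v) = W ∧ cnt o ω = 0} with hCW
  -- `a⋆` minimising `μ(U a)` over `A`
  obtain ⟨aS, haS, hmin⟩ := A.exists_min_image (fun a => μ.real (U a)) ⟨a₁, ha₁⟩
  refine ⟨aS, haS, fun a' ha' => hmin a' ha', ?_⟩
  -- each `min_a` in the error sum is at most the value at `a⋆`
  have hterm : ∀ W : Finset (Fin n),
      A.inf' ⟨a₁, ha₁⟩ (fun a => μ.real {ω : BondConfig (Fin n) |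
          (Finset.univ.filter fun v => ω ∈ openConn o v) = W ∧
            (A.filter fun x => ω ∈ openConn o x).card = 0 ∧
              j + 1 ≤ (A.filter fun x => ω ∈ openConn a x).card}) ≤
        μ.real (CW W ∩ U aS) := by
    intro W
    refine (Finset.inf'_le _ haS).trans (le_of_eq ?_)
    congr 1
    ext ω
    simp only [hCW, hU, hcnt, mem_setOf_eq, mem_inter_iff, and_assoc]
  -- the events `CW W` partition `{N = 0}`
  have hdisj : Set.PairwiseDisjoint (↑(Finset.univ : Finset (Finset (Fin n))))
      (fun W => CW W ∩ U aS) := by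
    intro W _ W' _ hne
    rw [Function.onFun, Set.disjoint_left]
    rintro ω ⟨⟨hW, -⟩, -⟩ ⟨⟨hW', -⟩, -⟩
    exact hne (hW.symm.trans hW')
  have hunion : (⋃ W ∈ (Finset.univ : Finset (Finset (Fin n))), CW W ∩ U aS) =
      {ω | cnt o ω = 0} ∩ U aS := by
    ext ω
    simp only [mem_iUnion, Finset.mem_univ, exists_true_left, mem_inter_iff, hCW, mem_setOf_eq]
    constructor
    · rintro ⟨W, ⟨-, h0⟩, hU'⟩
      exact ⟨h0, hU'⟩
    · rintro ⟨h0, hU'⟩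
      exact ⟨_, ⟨rfl, h0⟩, hU'⟩
  have hsum : ∑ W : Finset (Fin n), A.inf' ⟨a₁, ha₁⟩ (fun a => μ.real {ω : BondConfig (Fin n) |
          (Finset.univ.filter fun v => ω ∈ openConn o v) = W ∧
            (A.filter fun x => ω ∈ openConn o x).card = 0 ∧
              j + 1 ≤ (A.filter fun x => ω ∈ openConn a x).card}) ≤
      μ.real ({ω | cnt o ω = 0} ∩ U aS) := by
    calc _ ≤ ∑ W : Finset (Fin n), μ.real (CW W ∩ U aS) := Finset.sum_le_sum fun W _ => hterm W
      _ = μ.real (⋃ W ∈ (Finset.univ : Finset (Finset (Fin n))), CW W ∩ U aS) :=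
          (measureReal_biUnion_finset hdisj (fun W _ => MeasurableSet.of_discrete)).symm
      _ = μ.real ({ω | cnt o ω = 0} ∩ U aS) := by rw [hunion]
  -- hence `μ(U a⋆) ≤ μ(N ≥ j+1) + μ(N = 0, U a⋆)`
  have hkey : μ.real (U aS) ≤ μ.real (U o) + μ.real ({ω | cnt o ω = 0} ∩ U aS) := by
    calc μ.real (U aS) ≤ μ.real (U a₁) := hmin a₁ ha₁
      _ ≤ μ.real (U o) + _ := hgood
      _ ≤ μ.real (U o) + μ.real ({ω | cnt o ω = 0} ∩ U aS) := by linarith [hsum]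
  -- bookkeeping: `R = {N ≥ 1}`, `{1 ≤ N ≤ j} = R ∖ U o`, `U o ⊆ R`
  set R : Set (BondConfig (Fin n)) := ⋃ a' ∈ A, (openConn o a' : Set (BondConfig (Fin n))) with hR
  have hmemR : ∀ ω, ω ∈ R ↔ 1 ≤ cnt o ω := by
    intro ω
    simp only [hcnt]
    rw [Nat.succ_le_iff, Finset.card_pos, Finset.filter_nonempty_iff]
    simp only [hR, mem_iUnion, exists_prop]
  have hL : {ω : BondConfig (Fin n) | 1 ≤ (A.filter fun x => ω ∈ openConn o x).card ∧
      (A.filter fun x => ω ∈ openConn o x).card ≤ j} = R \ U o := by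
    ext ω
    simp only [mem_setOf_eq, mem_sdiff, hmemR, hU, hcnt, not_le]
    omega
  have hT : R \ U aS ⊆ R ∩ {ω : BondConfig (Fin n) | (A.filter fun x => ω ∈ openConn aS x).card ≤ j} := by
    rintro ω ⟨hωR, hωU⟩
    refine ⟨hωR, ?_⟩
    simp only [hU, hcnt, mem_setOf_eq, not_le] at hωU
    simp only [mem_setOf_eq]
    omega
  have hUoR : R ∩ U o = U o := by
    refine Set.inter_eq_right.2 fun ω hω => ?_
    rw [hmemR]
    simp only [hU, mem_setOf_eq] at hω
    omega
  -- `U a⋆` splits along `R`: `μ(U a⋆) = μ(R ∩ U a⋆) + μ({N = 0} ∩ U a⋆)`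
  have hsplitU : μ.real (U aS) = μ.real (U aS ∩ R) + μ.real (U aS \ R) :=
    (measureReal_inter_add_sdiff (MeasurableSet.of_discrete : MeasurableSet R) (measure_ne_top _ _)).symm
  have hzero : U aS \ R = {ω | cnt o ω = 0} ∩ U aS := by
    ext ω
    simp only [mem_sdiff, mem_inter_iff, mem_setOf_eq, hmemR, not_le, Nat.lt_one_iff]
    tauto
  have e1 : μ.real (R ∩ U o) + μ.real (R \ U o) = μ.real R :=
    measureReal_inter_add_sdiff (MeasurableSet.of_discrete : MeasurableSet (U o)) (measure_ne_top _ _)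
  have e2 : μ.real (R ∩ U aS) + μ.real (R \ U aS) = μ.real R :=
    measureReal_inter_add_sdiff (MeasurableSet.of_discrete : MeasurableSet (U aS)) (measure_ne_top _ _)
  have hRU : μ.real (R ∩ U aS) ≤ μ.real (R ∩ U o) := by
    rw [hUoR, inter_comm]
    rw [hzero] at hsplitU
    linarith [hkey, hsplitU]
  rw [hL]
  calc μ.real (R \ U o) = μ.real R - μ.real (R ∩ U o) := by linarith
    _ ≤ μ.real R - μ.real (R ∩ U aS) := by linarith
    _ = μ.real (R \ U aS) := by linarith
    _ ≤ μ.real (R ∩ {ω : BondConfig (Fin n) | (A.filter fun x => ω ∈ openConn aS x).card ≤ j}) :=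
        measureReal_mono hT

/-! ### The base case: goodness holds when the observer is joined only to relays -/

/-- **Theorem 8 with an explicit witness**: if `o ∉ A`, `o` is isolated in `G ∖ A`, and `a₀ ∈ A` minimises
`μ_{G∖o}(P(C(·)))` over `A` (`P` a monotone property of vertex sets), then
`μ(P(C(a₀)), o ↔ A) ≤ μ(P(C(o)), o ↔ A)`.  (Same proof as `Literature.….KozmaNitzan2024_thm8_event`, which
only asserts the existence of such an `a₀`.) [cite: KozmaNitzan2024, Thm. 8 (p. 32)] -/
theorem thm8_event_of_isMin {V : Type*} [Fintype V] (w : Sym2 V → unitInterval) (A : Finset V)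
    (o a₀ : V) (P : Set V → Prop) (hP : ∀ S T : Set V, S ⊆ T → P S → P T) (ha₀ : a₀ ∈ A)
    (hoA : o ∉ A) (hiso : ∀ u, u ≠ o → u ∉ A → w s(o, u) = 0)
    (hmin : ∀ u ∈ A, (prodBernoulli w).real {ω | P {y | ω ∈ openConnIn ({o}ᶜ : Set V) a₀ y}} ≤
      (prodBernoulli w).real {ω | P {y | ω ∈ openConnIn ({o}ᶜ : Set V) u y}}) :
    (prodBernoulli w).real ({ω | P (openCluster ω a₀)} ∩ ⋃ a' ∈ A, openConn o a') ≤
      (prodBernoulli w).real ({ω | P (openCluster ω o)} ∩ ⋃ a' ∈ A, openConn o a') := by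
  classical
  set μ := prodBernoulli w with hμ
  have ha₀o : a₀ ≠ o := fun h => hoA (h ▸ ha₀)
  rw [KNPreFKG.real_eq_sum_inter_starEvent w A o hoA hiso ({ω | P (openCluster ω a₀)} ∩ _),
    KNPreFKG.real_eq_sum_inter_starEvent w A o hoA hiso ({ω | P (openCluster ω o)} ∩ _)]
  refine Finset.sum_le_sum fun B hB => ?_
  have hBA : B ⊆ A := Finset.mem_powerset.1 hB
  rcases B.eq_empty_or_nonempty with rfl | ⟨v, hv⟩
  · have h0 : ({ω | P (openCluster ω a₀)} ∩ ⋃ a' ∈ A, openConn o a') ∩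
        starEvent o ↑(∅ : Finset V) = (∅ : Set (BondConfig V)) := by
      ext ω
      simp only [mem_inter_iff, mem_iUnion, exists_prop, mem_empty_iff_false, iff_false, not_and]
      rintro ⟨-, a', ha', hoa'⟩ hσ
      rw [Finset.coe_empty] at hσ
      exact KNPreFKG.not_reachable_of_mem_starEvent_empty hσ (fun h => hoA (h ▸ ha')) hoa'
    rw [h0, measureReal_empty]
    exact measureReal_nonneg
  · have hvo : v ≠ o := fun h => hoA (h ▸ hBA hv)
    have L5 := KozmaNitzan2024_lemma5_cluster w o a₀ v (↑B) P hP ha₀o hvo (Finset.mem_coe.2 hv)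
      (hmin v (hBA hv))
    have hσU : starEvent o (↑B : Set V) ⊆ ⋃ a' ∈ A, (openConn o a' : Set (BondConfig V)) := by
      intro ω hσ
      have hov : s(o, v) ∈ ω :=
        ((mem_starEvent_iff o (↑B) ω).1 hσ v hvo).2 (Finset.mem_coe.2 hv)
      have hadj : (openGraph ω).Adj o v := (openGraph_adj ω o v).2 ⟨hov, hvo.symm⟩
      exact mem_iUnion₂.2 ⟨v, hBA hv, hadj.reachable⟩
    calc μ.real (({ω | P (openCluster ω a₀)} ∩ ⋃ a' ∈ A, openConn o a') ∩ starEvent o ↑B)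
        ≤ μ.real ({ω | P (openCluster ω a₀)} ∩ starEvent o ↑B) :=
          measureReal_mono fun ω ⟨⟨h1, _⟩, h2⟩ => ⟨h1, h2⟩
      _ ≤ μ.real ({ω | P (openCluster ω o)} ∩ starEvent o ↑B) := L5
      _ ≤ μ.real (({ω | P (openCluster ω o)} ∩ ⋃ a' ∈ A, openConn o a') ∩ starEvent o ↑B) :=
          measureReal_mono fun ω ⟨h1, h2⟩ => ⟨⟨h1, hσU h2⟩, h2⟩

/-- Under `σ_∅` (every pair at `o` closed) the cluster of `a ≠ o` is its cluster off `o`: the event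
`{P(C(a))} ∩ σ_∅` is `σ_∅ ∩` the pull-back of `{P(C(a))}` from `G ∖ {o}`. [folklore] -/
theorem setOf_prop_openCluster_inter_starEvent_empty {V : Type*} (o a : V) (hao : a ≠ o)
    (P : Set V → Prop) (hP : ∀ S T : Set V, S ⊆ T → P S → P T) :
    {ω : BondConfig V | P (openCluster ω a)} ∩ starEvent o (∅ : Set V) =
      starEvent o (∅ : Set V) ∩ {ω | P {y | ω ∈ openConnIn ({o}ᶜ : Set V) a y}} := by
  ext ω
  constructor
  · rintro ⟨hPa, hσ⟩
    refine ⟨hσ, hP _ _ (fun x hx => ?_) hPa⟩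
    have hxo : x ≠ o := by
      rintro rfl
      exact KNPreFKG.not_reachable_of_mem_starEvent_empty hσ hao
        (hx : (openGraph ω).Reachable a x).symm
    obtain ⟨p⟩ := (hx : (openGraph ω).Reachable a x)
    rcases (KNPreFKG.walk_decomp hσ p hxo).1 hao with h | ⟨⟨u, hu, _⟩, _⟩
    · exact h
    · exact absurd hu (Set.notMem_empty u)
  · rintro ⟨hσ, hPa⟩
    exact ⟨hP _ _ (fun x hx => KNPreFKG.reachable_of_openConnIn hx) hPa, hσ⟩

/-- **Goodness holds when the observer is joined only to relays** (the base case, = the bookkeeping of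
Kozma–Nitzan's Theorem 4 for relay counts): if `o ∉ A`, `A ≠ ∅` and `o` is isolated in `G ∖ A`, then
`Good_{j+1}(G, A, o)` in the typed form of `cumulativeIsolation_of_goodness`, with `a₁` a minimiser of
`μ_{G∖o}(|π(·)| ≥ j+1)`: here the only relay-free cluster of `o` with positive probability is `{o}`, the error
term at `W = {o}` equals `μ(σ_∅)·min_a μ_{G∖o}(|π(a)| ≥ j+1) = μ(|π(a₁)| ≥ j+1, N = 0)`, and Theorem 8 gives
`μ(|π(a₁)| ≥ j+1, N ≥ 1) ≤ μ(N ≥ j+1)`. [cite: KozmaNitzan2024, Thm. 4 (pp. 12–14) and §3.2 (p. 12)] -/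
theorem goodness_of_isolatedObserver (w : Sym2 (Fin n) → unitInterval) (A : Finset (Fin n))
    (o : Fin n) (j : ℕ) (hA : A.Nonempty) (hoA : o ∉ A)
    (hiso : ∀ u, u ≠ o → u ∉ A → w s(o, u) = 0) :
    ∃ a₁, ∃ ha₁ : a₁ ∈ A,
      (prodBernoulli w).real {ω : BondConfig (Fin n) |
          j + 1 ≤ (A.filter fun x => ω ∈ openConn a₁ x).card} ≤
        (prodBernoulli w).real {ω : BondConfig (Fin n) |
            j + 1 ≤ (A.filter fun x => ω ∈ openConn o x).card} +
          ∑ W : Finset (Fin n), A.inf' ⟨a₁, ha₁⟩ (fun a =>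
            (prodBernoulli w).real {ω : BondConfig (Fin n) |
              (Finset.univ.filter fun v => ω ∈ openConn o v) = W ∧
                (A.filter fun x => ω ∈ openConn o x).card = 0 ∧
                  j + 1 ≤ (A.filter fun x => ω ∈ openConn a x).card}) := by
  set μ := prodBernoulli w with hμ
  set cnt : Fin n → BondConfig (Fin n) → ℕ := fun a ω => (A.filter fun x => ω ∈ openConn a x).card
    with hcnt
  set U : Fin n → Set (BondConfig (Fin n)) := fun a => {ω | j + 1 ≤ cnt a ω} with hU
  -- the monotone cluster property and its off-`o` version
  set P : Set (Fin n) → Prop := fun S => j + 1 ≤ (A.filter fun x => x ∈ S).card with hP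
  have hPmono : ∀ S T : Set (Fin n), S ⊆ T → P S → P T :=
    fun S T hST hS => le_trans hS (card_filter_mem_mono A hST)
  set F' : Fin n → ℝ := fun a => μ.real {ω | P {y | ω ∈ openConnIn ({o}ᶜ : Set (Fin n)) a y}} with hF'
  have hUP : ∀ a, U a = {ω | P (openCluster ω a)} := by
    intro a
    ext ω
    simp only [hU, hcnt, hP, mem_setOf_eq, card_filter_mem_openCluster]
  -- `a₁` minimising `F'` over `A`
  obtain ⟨a₁, ha₁, hmin⟩ := A.exists_min_image F' hA
  refine ⟨a₁, ha₁, ?_⟩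
  have ha₁o : a₁ ≠ o := fun h => hoA (h ▸ ha₁)
  set R : Set (BondConfig (Fin n)) := ⋃ a' ∈ A, (openConn o a' : Set (BondConfig (Fin n))) with hR
  set σ0 : Set (BondConfig (Fin n)) := starEvent o (∅ : Set (Fin n)) with hσ0
  -- Theorem 8 for the minimiser: `μ(U a₁ ∩ R) ≤ μ(U o ∩ R) ≤ μ(U o)`
  have h8 : μ.real (U a₁ ∩ R) ≤ μ.real (U o) := by
    rw [hUP a₁, hUP o]
    exact (thm8_event_of_isMin w A o a₁ P hPmono ha₁ hoA hiso hmin).trans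
      (measureReal_mono inter_subset_left)
  -- `μ(U a ∩ σ_∅) = μ(σ_∅) · F'(a)` for `a ≠ o`
  have hfac : ∀ a, a ≠ o → μ.real (U a ∩ σ0) = μ.real σ0 * F' a := by
    intro a hao
    rw [hUP a, hσ0, setOf_prop_openCluster_inter_starEvent_empty o a hao P hPmono,
      ← KNPreFKG.preimage_setOf_prop_openCluster o P ⟨a, mem_compl_singleton_iff.2 hao⟩,
      KNPreFKG.real_starEvent_inter_preimage, KNPreFKG.preimage_setOf_prop_openCluster]
  -- `μ(U a₁ ∖ R) = μ(U a₁ ∩ σ_∅)`: off `R = {o ↔ A}` only the empty star carries mass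
  have hoffR : μ.real (U a₁ \ R) = μ.real (U a₁ ∩ σ0) := by
    rw [KNPreFKG.real_eq_sum_inter_starEvent w A o hoA hiso (U a₁ \ R),
      Finset.sum_eq_single_of_mem ∅ (Finset.empty_mem_powerset A)]
    · rw [Finset.coe_empty]
      congr 1
      ext ω
      simp only [mem_inter_iff, mem_sdiff, hσ0]
      constructor
      · rintro ⟨⟨hU1, -⟩, hσ⟩
        exact ⟨hU1, hσ⟩
      · rintro ⟨hU1, hσ⟩
        refine ⟨⟨hU1, fun hRω => ?_⟩, hσ⟩
        simp only [hR, mem_iUnion, exists_prop] at hRω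
        obtain ⟨a', ha', hoa'⟩ := hRω
        exact KNPreFKG.not_reachable_of_mem_starEvent_empty hσ (fun h => hoA (h ▸ ha')) hoa'
    · intro B hB hBne
      have hBA : B ⊆ A := Finset.mem_powerset.1 hB
      obtain ⟨v, hv⟩ := Finset.nonempty_iff_ne_empty.2 hBne
      have hvo : v ≠ o := fun h => hoA (h ▸ hBA hv)
      have hsub : (U a₁ \ R) ∩ starEvent o ↑B = (∅ : Set (BondConfig (Fin n))) := by
        ext ω
        simp only [mem_inter_iff, mem_sdiff, mem_empty_iff_false, iff_false, not_and]
        rintro ⟨-, hRω⟩ hσ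
        apply hRω
        have hov : s(o, v) ∈ ω :=
          ((mem_starEvent_iff o (↑B) ω).1 hσ v hvo).2 (Finset.mem_coe.2 hv)
        have hadj : (openGraph ω).Adj o v := (openGraph_adj ω o v).2 ⟨hov, hvo.symm⟩
        simp only [hR, mem_iUnion, exists_prop]
        exact ⟨v, hBA hv, hadj.reachable⟩
      rw [hsub, measureReal_empty]
  -- the `W = {o}` error term is `inf'_a μ(σ_∅ ∩ U a) = μ(σ_∅) F'(a₁) = μ(U a₁ ∩ σ_∅)`
  have hWo : ∀ a ∈ A, {ω : BondConfig (Fin n) |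
      (Finset.univ.filter fun v => ω ∈ openConn o v) = {o} ∧
        (A.filter fun x => ω ∈ openConn o x).card = 0 ∧
          j + 1 ≤ (A.filter fun x => ω ∈ openConn a x).card} = U a ∩ σ0 := by
    intro a ha
    ext ω
    simp only [mem_setOf_eq, mem_inter_iff, hU, hcnt, hσ0]
    constructor
    · rintro ⟨hfil, -, hUa⟩
      refine ⟨hUa, (mem_starEvent_iff o ∅ ω).2 fun u huo => ?_⟩
      simp only [Set.mem_empty_iff_false, iff_false]
      intro hou
      have hadj : (openGraph ω).Adj o u := (openGraph_adj ω o u).2 ⟨hou, huo.symm⟩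
      have hu : u ∈ Finset.univ.filter fun v => ω ∈ openConn o v :=
        Finset.mem_filter.2 ⟨Finset.mem_univ _, hadj.reachable⟩
      rw [hfil, Finset.mem_singleton] at hu
      exact huo hu
    · rintro ⟨hUa, hσ⟩
      have hiso' : ∀ u, u ≠ o → ¬ (openGraph ω).Reachable o u :=
        fun u huo => KNPreFKG.not_reachable_of_mem_starEvent_empty hσ huo
      refine ⟨?_, ?_, hUa⟩
      · ext v
        simp only [Finset.mem_filter, Finset.mem_univ, true_and, Finset.mem_singleton]
        constructor
        · intro hv
          by_contra hvo
          exact hiso' v hvo hv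
        · rintro rfl
          exact SimpleGraph.Reachable.refl _
      · rw [Finset.card_eq_zero, Finset.filter_eq_empty_iff]
        intro x hx hox
        exact hiso' x (fun h => hoA (h ▸ hx)) hox
  have hterm : A.inf' ⟨a₁, ha₁⟩ (fun a => μ.real {ω : BondConfig (Fin n) |
      (Finset.univ.filter fun v => ω ∈ openConn o v) = {o} ∧
        (A.filter fun x => ω ∈ openConn o x).card = 0 ∧
          j + 1 ≤ (A.filter fun x => ω ∈ openConn a x).card}) = μ.real (U a₁ ∩ σ0) := by
    apply le_antisymm
    · exact (Finset.inf'_le _ ha₁).trans (by rw [hWo a₁ ha₁])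
    · refine Finset.le_inf' _ _ fun a ha => ?_
      rw [hWo a ha, hfac a (fun h => hoA (h ▸ ha)), hfac a₁ ha₁o]
      exact mul_le_mul_of_nonneg_left (hmin a ha) measureReal_nonneg
  -- the error sum is at least its `W = {o}` term
  have hsum : μ.real (U a₁ ∩ σ0) ≤ ∑ W : Finset (Fin n), A.inf' ⟨a₁, ha₁⟩ (fun a =>
      μ.real {ω : BondConfig (Fin n) |
        (Finset.univ.filter fun v => ω ∈ openConn o v) = W ∧
          (A.filter fun x => ω ∈ openConn o x).card = 0 ∧
            j + 1 ≤ (A.filter fun x => ω ∈ openConn a x).card}) := by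
    have hnonneg : ∀ W ∈ (Finset.univ : Finset (Finset (Fin n))),
        (0 : ℝ) ≤ A.inf' ⟨a₁, ha₁⟩ (fun a => μ.real {ω : BondConfig (Fin n) |
          (Finset.univ.filter fun v => ω ∈ openConn o v) = W ∧
            (A.filter fun x => ω ∈ openConn o x).card = 0 ∧
              j + 1 ≤ (A.filter fun x => ω ∈ openConn a x).card}) :=
      fun W _ => Finset.le_inf' _ _ fun a _ => measureReal_nonneg
    rw [← hterm]
    exact Finset.single_le_sum hnonneg (Finset.mem_univ ({o} : Finset (Fin n)))
  -- assemble: `μ(U a₁) = μ(U a₁ ∩ R) + μ(U a₁ ∖ R) ≤ μ(U o) + error`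
  have hsplit : μ.real (U a₁) = μ.real (U a₁ ∩ R) + μ.real (U a₁ \ R) :=
    (measureReal_inter_add_sdiff (MeasurableSet.of_discrete : MeasurableSet R) (measure_ne_top _ _)).symm
  calc μ.real (U a₁) = μ.real (U a₁ ∩ R) + μ.real (U a₁ \ R) := hsplit
    _ ≤ μ.real (U o) + μ.real (U a₁ ∩ σ0) := by rw [hoffR]; exact add_le_add h8 le_rfl
    _ ≤ _ := add_le_add le_rfl hsum

end Summit.CriticalPhenomena.PercolationContinuityZ3.Theorems

end
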